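/-
Copyright (c) 2026 the pub-hodgecm-mathlib formalisation cell (harness21).  Prover seat hodgecm-mathlib-LH5-p04 (g5): (C5)′ «TorusAll» ADAPTER (LH4-plan (g7) deal 15:56:21Z;
LH4-p01 (g6) CENSUS-Large 1cf8027116befc32 §0 (4)∕(7)(c)∕(8)); census `F0/P3c/LH5/LH5-p04/g5/c5torusall/CENSUS-C5-TorusAll.v1.md` 91466dbe3a824f0f; 2026-09-02.
-/
import Literature.NumberTheory.Automorphic.UnitaryThreeTorusBlockElementsTrace   -- ★ F1 (LH3-p02 (g6)): the trace torus literal `M(x, e, y)`, `v_eq_one_of_add_map_eq_one`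
import HarnessLib

/-!
# The `j = 0` REGIME LETTERS of the trace torus literal — `κ, G, r, s` and their valuations (the (C5)′ TorusAll ∕ Large adapter)
# (Flicker 1998 Prop. 13; the 2-free re-lettering of `(A − b)∕B = f + g`)

Topic `NumberTheory/Automorphic`; namespace `Literature.NumberTheory.Automorphic.UnitaryGroup`.  THEOREMS ONLY (no `def`, no instance, no notation, no named fact, no `sorry`);
count-neutral; kernel lane `--supports stmt-HodgeConjecture-24833`.  Cell `pub/hodgecm-mathlib` (D-0151), crux H413 = `stmt-HodgeConjecture-24833`, LH4 board (D-UNR) list (5), (C5)′.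

WHAT.  ★ `Rogawski1990/UnitOrbitalIntegralInertCountJZeroLarge`∕`…TorusAll` (Flicker's Prop. 13, `j = 0`) parametrise the corner `(A, B; B, A)` of Flicker's torus by the ratio
`(A − b)∕B = f + g` (`σf = f`, `σg = −g`, `e = ½` inside).  The trace-frame twin `…CountJZeroLargeTrace` (LH4-p01 (g6), CENSUS-Large §0 (4)∕(8)) reads instead, for a corner
`!![A, 0, B₁; 0, b, 0; B₂, 0, D]` and the level element's fibre constant `s`, the LETTERS `κ, b₀, G, r` bound by
`(htrκ : κ + σκ ≠ 0) (hκ : |κ| ≤ 1) (hB₁ : B₁ = κ·σκ·B₂) (hAD : A − D = (σκ − κ)·B₂) (hG : B₂·G = (D − b − κB₂)·s) (hr : r·(κ + σκ) = b₀·G + σb₀·σG) (hb₀ : b₀ + σb₀ = 1)`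
and the EXPONENT DICTIONARY `|B₂| = |ϖ^N|`, `|G − σG| = |ϖ^M|`, `|r(s+r)| = |ϖ^{M−N}|` (resp. `≤`), type A `|D − b| = |ϖ^{N₊}|`.  THIS FILE DISCHARGES THEM AT THE TRACE TORUS LITERAL ★ F1
`M(x₁, x₂, x₃) = !![x₁σb + x₃b, 0, π(x₁ − x₃); 0, x₂, 0; π′·bσb(x₁ − x₃), 0, x₁b + x₃σb]` (`b + σb = 1`, `ππ′ = 1`, `σπ = π`, norm-one `xᵢ`, `σs = s`), with the CHOICES
**`κ := π∕σb`**, **`b₀ := b`**, and the resulting CLOSED FORMS (machine-checked numerically in the norm-one model before typing):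
* `κσκ = π²∕(bσb)`, `κ + σκ = π∕(bσb)`; `hB₁`, `hAD` (`A − D = (x₁ − x₃)(σb − b)`); `D − x₂ − κB₂ = x₃ − x₂`, so **`G = π(x₃ − x₂)s∕(bσb(x₁ − x₃))`**,
  `σG = π(x₃ − x₂)x₁s∕(bσb(x₁ − x₃)x₂)`, **`G − σG = π(x₃ − x₂)(x₂ − x₁)s∕(bσb(x₁ − x₃)x₂)`**;
* **`r = (x₃ − x₂)·s·(bx₂ + σb·x₁)∕((x₁ − x₃)x₂)`** (π-FREE), **`s + r = s(x₁ − x₂)(bx₂ + σb·x₃)∕((x₁ − x₃)x₂)`**, **`r(s + r) = s²(x₃ − x₂)(x₁ − x₂)(bx₂ + σbx₁)(bx₂ + σbx₃)∕((x₁ − x₃)²x₂²)`**,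
  with `bx₂ + σbx₁ = x₂ + σb(x₁ − x₂)` a UNIT as soon as `|x₁ − x₂| < 1` (and symmetrically) — hence `|r(s+r)| = |x₃ − x₂||x₁ − x₂|∕|x₁ − x₃|²` EXACTLY when `N₁, N₂ ≥ 1` and `≤` always:
  the same `N ≥ 1` caveat as ★'s `hc₁` ∕ ED. 2 `…_of_lt'`;
* `A − x₂ = (x₁ − x₂) + (x₃ − x₁)b` (= ★ `traceCorner_eq`'s `E`), `D − x₂ = (x₁ − x₂) + (x₃ − x₁)σb`; type A (`|x₃ − x₁| < |E|`): `|D − x₂| = |A − x₂| = |x₁ − x₂|`.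
§1 = the ring identities (any field `K`, `σ : K →+* K` with `σσ = id` where needed); §2 = the valuation readings (any `Valued K Γ₀`, `σ` isometric) in MULTIPLICATIVE form (no `ϖ`-exponent
arithmetic — the consumer's `omega`), plus the `ϖ`-power corollaries under `N₁ + N₂ = N + M` (type B).  HONEST READER LABEL: base-layer algebra for the (C5)′ column; pays no organ, opens no
road ((D-UNR) PRINT by D74′); asserts NO cell value (FINDING #19 ∕ D1–D2 untouched); HC_CM is proved only modulo the 7 printed citations (2 remaining named inputs: hLiu418 =
stmt-HodgeConjecture-24832, h413 = stmt-HodgeConjecture-24833) until rung 0 closes.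

## References
* [Flicker1998UnitaryFL] Y. Z. Flicker, *Elementary proof of the fundamental lemma for a unitary group*, Canad. J. Math. 50 (1998), Prop. 13 pp. 91–93 (the `j = 0` count and its
  regimes in the ratio `(A − b)∕B`), Prop. 6 p. 83 (the torus), §2 Prop. 3 pp. 78–79.
* [Rogawski1990] J. D. Rogawski, *Automorphic Representations of Unitary Groups in Three Variables* (1990), §4.9 Prop. 4.9.1 p. 55.
-/

set_option autoImplicit false

open Matrix
open scoped MatrixGroups

namespace Literature.NumberTheory.Automorphic.UnitaryGroup

/-! ## §1 The letters `κ = π∕σb`, `G`, `r` at the trace torus literal: ring identities -/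

section Ring

variable {K : Type*} [Field K] (σ : K →+* K)

/-- `κσκ = π²∕(bσb)` for `κ = π∕σb` (`σσ = id`, `σπ = π`). [cite: Flicker1998UnitaryFL, Prop. 13 p. 91] -/
theorem traceKappa_mul_map (hσσ : ∀ z, σ (σ z) = z) {b π : K} (hσπ : σ π = π) (hb0 : b ≠ 0) (hσb0 : σ b ≠ 0) :
    π / σ b * σ (π / σ b) = π ^ 2 / (b * σ b) := by
  rw [map_div₀, hσπ, hσσ]
  field_simp

/-- `κ + σκ = π∕(bσb)` for `κ = π∕σb` (`σσ = id`, `σπ = π`, `b + σb = 1`). [cite: Flicker1998UnitaryFL, Prop. 13 p. 91] -/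
theorem traceKappa_add_map (hσσ : ∀ z, σ (σ z) = z) {b π : K} (hb : b + σ b = 1) (hσπ : σ π = π) (hb0 : b ≠ 0) (hσb0 : σ b ≠ 0) :
    π / σ b + σ (π / σ b) = π / (b * σ b) := by
  have hσb : σ b = 1 - b := by linear_combination hb
  have h1b : (1 - b : K) ≠ 0 := by rw [← hσb]; exact hσb0
  rw [map_div₀, hσπ, hσσ, hσb]
  field_simp
  ring

/-- **`κ + σκ ≠ 0`** (`= π∕(bσb)`, `π ≠ 0`). [cite: Flicker1998UnitaryFL, Prop. 13 p. 91] -/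
theorem traceKappa_add_map_ne_zero (hσσ : ∀ z, σ (σ z) = z) {b π : K} (hb : b + σ b = 1) (hσπ : σ π = π) (hb0 : b ≠ 0) (hσb0 : σ b ≠ 0) (hπ0 : π ≠ 0) :
    π / σ b + σ (π / σ b) ≠ 0 := by
  rw [traceKappa_add_map σ hσσ hb hσπ hb0 hσb0]
  exact div_ne_zero hπ0 (mul_ne_zero hb0 hσb0)

/-- **`hB₁`: `B₁ = κσκ·B₂`** at the literal — `π(x₁ − x₃) = (π∕σb)·σ(π∕σb)·(π′·bσb(x₁ − x₃))` (`ππ′ = 1`). [cite: Flicker1998UnitaryFL, Prop. 13 p. 91] -/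
theorem traceCorner_B₁_eq (hσσ : ∀ z, σ (σ z) = z) {b π π' : K} (hππ : π * π' = 1) (hσπ : σ π = π) (hb0 : b ≠ 0) (hσb0 : σ b ≠ 0) (x₁ x₃ : K) :
    π * (x₁ - x₃) = π / σ b * σ (π / σ b) * (π' * (b * σ b * (x₁ - x₃))) := by
  have hπ0 : π ≠ 0 := fun h => by rw [h, zero_mul] at hππ; exact zero_ne_one hππ
  have hπ' : π' = π⁻¹ := eq_inv_of_mul_eq_one_right hππ
  rw [traceKappa_mul_map σ hσσ hσπ hb0 hσb0, hπ']
  field_simp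

/-- **`hAD`: `A − D = (σκ − κ)·B₂`** at the literal — both sides are `(x₁ − x₃)(σb − b)`. [cite: Flicker1998UnitaryFL, Prop. 13 p. 91] -/
theorem traceCorner_A_sub_D (hσσ : ∀ z, σ (σ z) = z) {b π π' : K} (hππ : π * π' = 1) (hσπ : σ π = π) (hb0 : b ≠ 0) (hσb0 : σ b ≠ 0) (x₁ x₃ : K) :
    (x₁ * σ b + x₃ * b) - (x₁ * b + x₃ * σ b) = (σ (π / σ b) - π / σ b) * (π' * (b * σ b * (x₁ - x₃))) := by
  have hπ0 : π ≠ 0 := fun h => by rw [h, zero_mul] at hππ; exact zero_ne_one hππ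
  have hπ' : π' = π⁻¹ := eq_inv_of_mul_eq_one_right hππ
  rw [map_div₀, hσπ, hσσ, hπ']
  field_simp
  ring

/-- `D − x₂ − κB₂ = x₃ − x₂` at the literal (`κB₂ = b(x₁ − x₃)`, `b + σb = 1`): the defect entering `G`. [cite: Flicker1998UnitaryFL, Prop. 13 p. 91] -/
theorem traceCorner_D_sub_sub_kappa_mul {b π π' : K} (hb : b + σ b = 1) (hππ : π * π' = 1) (hσb0 : σ b ≠ 0) (x₁ x₂ x₃ : K) :
    (x₁ * b + x₃ * σ b) - x₂ - π / σ b * (π' * (b * σ b * (x₁ - x₃))) = x₃ - x₂ := by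
  have hπ0 : π ≠ 0 := fun h => by rw [h, zero_mul] at hππ; exact zero_ne_one hππ
  have hπ' : π' = π⁻¹ := eq_inv_of_mul_eq_one_right hππ
  have hσb : σ b = 1 - b := by linear_combination hb
  have h1b : (1 - b : K) ≠ 0 := by rw [← hσb]; exact hσb0
  rw [hπ', hσb]
  field_simp
  ring

/-- **`hG`: `B₂·G = (D − x₂ − κB₂)·s`** for **`G := π(x₃ − x₂)s∕(bσb(x₁ − x₃))`** at the literal (`x₁ ≠ x₃`). [cite: Flicker1998UnitaryFL, Prop. 13 p. 91] -/
theorem traceCorner_G_spec {b π π' : K} (hb : b + σ b = 1) (hππ : π * π' = 1) (hb0 : b ≠ 0) (hσb0 : σ b ≠ 0) {x₁ x₂ x₃ : K} (h13 : x₁ ≠ x₃) (s : K) :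
    π' * (b * σ b * (x₁ - x₃)) * (π * (x₃ - x₂) * s / (b * σ b * (x₁ - x₃))) = ((x₁ * b + x₃ * σ b) - x₂ - π / σ b * (π' * (b * σ b * (x₁ - x₃)))) * s := by
  rw [traceCorner_D_sub_sub_kappa_mul σ hb hππ hσb0]
  have h13' : x₁ - x₃ ≠ 0 := sub_ne_zero.2 h13
  field_simp
  linear_combination ((x₃ - x₂) * s) * hππ

/-- **`σG = π(x₃ − x₂)x₁s∕(bσb(x₁ − x₃)x₂)`** for norm-one `x₁, x₂, x₃` (`σxᵢ·xᵢ = 1`), `σs = s`, `σπ = π`, `σσ = id`. [cite: Flicker1998UnitaryFL, Prop. 13 p. 91] -/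
theorem traceCorner_map_G (hσσ : ∀ z, σ (σ z) = z) {b π s x₁ x₂ x₃ : K} (hσπ : σ π = π) (hσs : σ s = s) (hb0 : b ≠ 0) (hσb0 : σ b ≠ 0)
    (hx₁ : σ x₁ * x₁ = 1) (hx₂ : σ x₂ * x₂ = 1) (hx₃ : σ x₃ * x₃ = 1) (h13 : x₁ ≠ x₃) :
    σ (π * (x₃ - x₂) * s / (b * σ b * (x₁ - x₃))) = π * (x₃ - x₂) * x₁ * s / (b * σ b * (x₁ - x₃) * x₂) := by
  have hx10 : x₁ ≠ 0 := fun h => by rw [h, mul_zero] at hx₁; exact zero_ne_one hx₁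
  have hx20 : x₂ ≠ 0 := fun h => by rw [h, mul_zero] at hx₂; exact zero_ne_one hx₂
  have hx30 : x₃ ≠ 0 := fun h => by rw [h, mul_zero] at hx₃; exact zero_ne_one hx₃
  have hσ1 : σ x₁ = x₁⁻¹ := eq_inv_of_mul_eq_one_left hx₁
  have hσ2 : σ x₂ = x₂⁻¹ := eq_inv_of_mul_eq_one_left hx₂
  have hσ3 : σ x₃ = x₃⁻¹ := eq_inv_of_mul_eq_one_left hx₃
  have h13' : x₁ - x₃ ≠ 0 := sub_ne_zero.2 h13
  have h31' : x₃ - x₁ ≠ 0 := sub_ne_zero.2 (Ne.symm h13)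
  simp only [map_div₀, map_mul, map_sub, hσπ, hσs, hσσ, hσ1, hσ2, hσ3]
  field_simp
  ring

/-- **`G − σG = π(x₃ − x₂)(x₂ − x₁)s∕(bσb(x₁ − x₃)x₂)`** — its order is `N₂ + N₁ − N = M` in type B (§2). [cite: Flicker1998UnitaryFL, Prop. 13 pp. 91–93] -/
theorem traceCorner_G_sub_map_G (hσσ : ∀ z, σ (σ z) = z) {b π s x₁ x₂ x₃ : K} (hσπ : σ π = π) (hσs : σ s = s) (hb0 : b ≠ 0) (hσb0 : σ b ≠ 0)
    (hx₁ : σ x₁ * x₁ = 1) (hx₂ : σ x₂ * x₂ = 1) (hx₃ : σ x₃ * x₃ = 1) (h13 : x₁ ≠ x₃) :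
    π * (x₃ - x₂) * s / (b * σ b * (x₁ - x₃)) - σ (π * (x₃ - x₂) * s / (b * σ b * (x₁ - x₃))) =
      π * (x₃ - x₂) * (x₂ - x₁) * s / (b * σ b * (x₁ - x₃) * x₂) := by
  have hx20 : x₂ ≠ 0 := fun h => by rw [h, mul_zero] at hx₂; exact zero_ne_one hx₂
  have h13' : x₁ - x₃ ≠ 0 := sub_ne_zero.2 h13
  rw [traceCorner_map_G σ hσσ hσπ hσs hb0 hσb0 hx₁ hx₂ hx₃ h13]
  field_simp

/-- **`hr`: `r·(κ + σκ) = b·G + σb·σG`** for **`r := (x₃ − x₂)·s·(bx₂ + σb·x₁)∕((x₁ − x₃)x₂)`** (π-free!), `b₀ := b`. [cite: Flicker1998UnitaryFL, Prop. 13 p. 91] -/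
theorem traceCorner_r_spec (hσσ : ∀ z, σ (σ z) = z) {b π s x₁ x₂ x₃ : K} (hb : b + σ b = 1) (hσπ : σ π = π) (hσs : σ s = s) (hb0 : b ≠ 0) (hσb0 : σ b ≠ 0)
    (hx₁ : σ x₁ * x₁ = 1) (hx₂ : σ x₂ * x₂ = 1) (hx₃ : σ x₃ * x₃ = 1) (h13 : x₁ ≠ x₃) :
    (x₃ - x₂) * s * (b * x₂ + σ b * x₁) / ((x₁ - x₃) * x₂) * (π / σ b + σ (π / σ b)) =
      b * (π * (x₃ - x₂) * s / (b * σ b * (x₁ - x₃))) + σ b * σ (π * (x₃ - x₂) * s / (b * σ b * (x₁ - x₃))) := by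
  have hx20 : x₂ ≠ 0 := fun h => by rw [h, mul_zero] at hx₂; exact zero_ne_one hx₂
  have h13' : x₁ - x₃ ≠ 0 := sub_ne_zero.2 h13
  rw [traceKappa_add_map σ hσσ hb hσπ hb0 hσb0, traceCorner_map_G σ hσσ hσπ hσs hb0 hσb0 hx₁ hx₂ hx₃ h13]
  field_simp

/-- **`s + r = s(x₁ − x₂)(bx₂ + σb·x₃)∕((x₁ − x₃)x₂)`** (`b + σb = 1`). [cite: Flicker1998UnitaryFL, Prop. 13 pp. 91–93] -/
theorem traceCorner_s_add_r {b s x₁ x₂ x₃ : K} (hb : b + σ b = 1) (hx20 : x₂ ≠ 0) (h13 : x₁ ≠ x₃) :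
    s + (x₃ - x₂) * s * (b * x₂ + σ b * x₁) / ((x₁ - x₃) * x₂) = s * (x₁ - x₂) * (b * x₂ + σ b * x₃) / ((x₁ - x₃) * x₂) := by
  have h13' : x₁ - x₃ ≠ 0 := sub_ne_zero.2 h13
  have hσb : σ b = 1 - b := by linear_combination hb
  rw [hσb]
  field_simp
  ring

/-- **`C := r(s + r) = s²(x₃ − x₂)(x₁ − x₂)(bx₂ + σbx₁)(bx₂ + σbx₃)∕((x₁ − x₃)²x₂²)`** — the trace-frame twin of ★'s `c₁ = f² − 1` (order `N₂ + N₁ − 2N = M − N` in type B when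
`N ≥ 1`, §2). [cite: Flicker1998UnitaryFL, Prop. 13 pp. 91–93] -/
theorem traceCorner_r_mul_s_add_r {b s x₁ x₂ x₃ : K} (hb : b + σ b = 1) (hx20 : x₂ ≠ 0) (h13 : x₁ ≠ x₃) :
    (x₃ - x₂) * s * (b * x₂ + σ b * x₁) / ((x₁ - x₃) * x₂) * (s + (x₃ - x₂) * s * (b * x₂ + σ b * x₁) / ((x₁ - x₃) * x₂)) =
      s ^ 2 * (x₃ - x₂) * (x₁ - x₂) * (b * x₂ + σ b * x₁) * (b * x₂ + σ b * x₃) / ((x₁ - x₃) ^ 2 * x₂ ^ 2) := by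
  have h13' : x₁ - x₃ ≠ 0 := sub_ne_zero.2 h13
  rw [traceCorner_s_add_r σ hb hx20 h13]
  field_simp

/-- `bx₂ + σb·x₁ = x₂ + σb(x₁ − x₂)` (`b + σb = 1`): a UNIT when `|x₁ − x₂| < 1` (§2). [cite: Flicker1998UnitaryFL, Prop. 13 p. 92] -/
theorem traceCorner_unit_eq {b : K} (hb : b + σ b = 1) (x₁ x₂ : K) : b * x₂ + σ b * x₁ = x₂ + σ b * (x₁ - x₂) := by
  linear_combination x₂ * hb

/-- `A − x₂ = (x₁ − x₂) + (x₃ − x₁)b` (= ★ `traceCorner_eq`'s `E`) and `D − x₂ = (x₁ − x₂) + (x₃ − x₁)σb` at the literal (`b + σb = 1`). [cite: Flicker1998UnitaryFL, Prop. 13 p. 91] -/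
theorem traceCorner_sub_mid {b : K} (hb : b + σ b = 1) (x₁ x₂ x₃ : K) :
    (x₁ * σ b + x₃ * b) - x₂ = (x₁ - x₂) + (x₃ - x₁) * b ∧ (x₁ * b + x₃ * σ b) - x₂ = (x₁ - x₂) + (x₃ - x₁) * σ b := by
  constructor
  · linear_combination x₁ * hb
  · linear_combination x₁ * hb

end Ring

/-! ## §2 Valuation readings (any `Valued K Γ₀`, `σ` isometric): the exponent dictionary in multiplicative form -/

section Valued

variable {K : Type*} [Field K] {Γ₀ : Type*} [LinearOrderedCommGroupWithZero Γ₀] [Valued K Γ₀] (σ : K →+* K)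

/-- **`|x₂ + σb(x₁ − x₂)| = 1`** when `|x₂| = 1`, `|σb| ≤ 1`, `|x₁ − x₂| < 1` — the unit factor of `r` (and, with `x₃`, of `s + r`). [cite: Flicker1998UnitaryFL, Prop. 13 p. 92] -/
theorem v_add_mul_sub_eq_one {b x₁ x₂ : K} (hx₂ : Valued.v x₂ = 1) (hσb : Valued.v (σ b) ≤ 1) (h12 : Valued.v (x₁ - x₂) < 1) :
    Valued.v (x₂ + σ b * (x₁ - x₂)) = 1 := by
  have hlt : Valued.v (σ b * (x₁ - x₂)) < Valued.v x₂ := by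
    rw [map_mul, hx₂]
    calc Valued.v (σ b) * Valued.v (x₁ - x₂) ≤ 1 * Valued.v (x₁ - x₂) := mul_le_mul' hσb le_rfl
      _ = Valued.v (x₁ - x₂) := one_mul _
      _ < 1 := h12
  rw [Valuation.map_add_eq_of_lt_left _ hlt, hx₂]

/-- `|x₂ + σb(x₁ − x₂)| ≤ 1` always (`|x₂|, |σb|, |x₁ − x₂| ≤ 1`). [cite: Flicker1998UnitaryFL, Prop. 13 p. 92] -/
theorem v_add_mul_sub_le_one {b x₁ x₂ : K} (hx₂ : Valued.v x₂ ≤ 1) (hσb : Valued.v (σ b) ≤ 1) (h12 : Valued.v (x₁ - x₂) ≤ 1) :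
    Valued.v (x₂ + σ b * (x₁ - x₂)) ≤ 1 := by
  refine (Valuation.map_add _ _ _).trans (max_le hx₂ ?_)
  rw [map_mul]
  exact (mul_le_mul' hσb h12).trans_eq (one_mul 1)

/-- **`|G − σG|·|x₁ − x₃| = |π|·|x₃ − x₂|·|x₂ − x₁|`** (given `|s| = |b| = |σb| = |x₂| = 1`) — the dictionary entry `|g| = |ϖ^M|` in multiplicative form.
[cite: Flicker1998UnitaryFL, Prop. 13 pp. 91–93] -/
theorem v_G_sub_map_G_mul (hσσ : ∀ z, σ (σ z) = z) {b π s x₁ x₂ x₃ : K} (hσπ : σ π = π) (hσs : σ s = s)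
    (hbv : Valued.v b = 1) (hσbv : Valued.v (σ b) = 1) (hsv : Valued.v s = 1)
    (hx₁ : σ x₁ * x₁ = 1) (hx₂ : σ x₂ * x₂ = 1) (hx₃ : σ x₃ * x₃ = 1) (hx₂v : Valued.v x₂ = 1) (h13 : x₁ ≠ x₃) :
    Valued.v (π * (x₃ - x₂) * s / (b * σ b * (x₁ - x₃)) - σ (π * (x₃ - x₂) * s / (b * σ b * (x₁ - x₃)))) * Valued.v (x₁ - x₃) =
      Valued.v π * Valued.v (x₃ - x₂) * Valued.v (x₂ - x₁) := by
  have hb0 : b ≠ 0 := fun h => by rw [h, map_zero] at hbv; exact zero_ne_one hbv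
  have hσb0 : σ b ≠ 0 := fun h => by rw [h, map_zero] at hσbv; exact zero_ne_one hσbv
  have h13v : Valued.v (x₁ - x₃) ≠ 0 := (Valuation.ne_zero_iff _).2 (sub_ne_zero.2 h13)
  rw [traceCorner_G_sub_map_G σ hσσ hσπ hσs hb0 hσb0 hx₁ hx₂ hx₃ h13]
  simp only [map_div₀, map_mul, hsv, hbv, hσbv, hx₂v, mul_one, one_mul]
  exact div_mul_cancel₀ _ h13v

/-- **`|r(s+r)|·|x₁ − x₃|² = |x₃ − x₂|·|x₁ − x₂|·|x₂ + σb(x₁ − x₂)|·|x₂ + σb(x₃ − x₂)|`** (given `|s| = |x₂| = 1`) — the dictionary entry `|c₁| = |ϖ^{M−N}|` in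
multiplicative form; the two unit factors are `1` when `N₁, N₂ ≥ 1` (`v_add_mul_sub_eq_one`) and `≤ 1` always. [cite: Flicker1998UnitaryFL, Prop. 13 pp. 91–93] -/
theorem v_r_mul_s_add_r_mul {b s x₁ x₂ x₃ : K} (hb : b + σ b = 1) (hsv : Valued.v s = 1) (hx₂v : Valued.v x₂ = 1) (h13 : x₁ ≠ x₃) :
    Valued.v ((x₃ - x₂) * s * (b * x₂ + σ b * x₁) / ((x₁ - x₃) * x₂) * (s + (x₃ - x₂) * s * (b * x₂ + σ b * x₁) / ((x₁ - x₃) * x₂))) *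
        Valued.v (x₁ - x₃) ^ 2 =
      Valued.v (x₃ - x₂) * Valued.v (x₁ - x₂) * Valued.v (x₂ + σ b * (x₁ - x₂)) * Valued.v (x₂ + σ b * (x₃ - x₂)) := by
  have hx20 : x₂ ≠ 0 := fun h => by rw [h, map_zero] at hx₂v; exact zero_ne_one hx₂v
  have h13v : Valued.v (x₁ - x₃) ≠ 0 := (Valuation.ne_zero_iff _).2 (sub_ne_zero.2 h13)
  rw [traceCorner_r_mul_s_add_r σ hb hx20 h13, traceCorner_unit_eq σ hb x₁ x₂, traceCorner_unit_eq σ hb x₃ x₂]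
  simp only [map_div₀, map_mul, map_pow, hsv, hx₂v, one_pow, one_mul, mul_one]
  exact div_mul_cancel₀ _ (pow_ne_zero 2 h13v)

/-- **TYPE A READING**: if `|(x₃ − x₁)·c| < |x₁ − x₂|` then `|(x₁ − x₂) + (x₃ − x₁)·c| = |x₁ − x₂|` — with `c = b` this is `|A − x₂| = |E|`, with `c = σb` it is
`|D − x₂|` (`traceCorner_sub_mid`); in type A (`N₊ < N`, `|c| ≤ 1`) the hypothesis holds. [cite: Flicker1998UnitaryFL, Prop. 13 p. 91] -/
theorem v_sub_add_mul_eq_of_lt {x₁ x₂ x₃ c : K} (h : Valued.v ((x₃ - x₁) * c) < Valued.v (x₁ - x₂)) :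
    Valued.v ((x₁ - x₂) + (x₃ - x₁) * c) = Valued.v (x₁ - x₂) :=
  Valuation.map_add_eq_of_lt_left _ h

/-! ### `ϖ`-power corollaries (type B: `N₁ + N₂ = N + M`, `N ≤ M`) -/

/-- **`|G − σG| = |ϖ^M|`** at `|π| = 1` from `|x₁ − x₃| = |ϖ^N|`, `|x₁ − x₂| = |ϖ^{N₁}|`, `|x₃ − x₂| = |ϖ^{N₂}|`, `N₁ + N₂ = N + M` (`ϖ ≠ 0`) — CENSUS-Large §0 (4) `hGv`.
[cite: Flicker1998UnitaryFL, Prop. 13 pp. 91–93] -/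
theorem v_G_sub_map_G_eq_pow (hσσ : ∀ z, σ (σ z) = z) {b π s x₁ x₂ x₃ ϖ : K} {N N₁ N₂ M : ℕ} (hσπ : σ π = π) (hσs : σ s = s) (hπv : Valued.v π = 1)
    (hbv : Valued.v b = 1) (hσbv : Valued.v (σ b) = 1) (hsv : Valued.v s = 1)
    (hx₁ : σ x₁ * x₁ = 1) (hx₂ : σ x₂ * x₂ = 1) (hx₃ : σ x₃ * x₃ = 1) (hx₂v : Valued.v x₂ = 1) (hϖ : ϖ ≠ 0)
    (hN : Valued.v (x₁ - x₃) = Valued.v (ϖ ^ N)) (hN₁ : Valued.v (x₁ - x₂) = Valued.v (ϖ ^ N₁)) (hN₂ : Valued.v (x₃ - x₂) = Valued.v (ϖ ^ N₂))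
    (hsum : N₁ + N₂ = N + M) :
    Valued.v (π * (x₃ - x₂) * s / (b * σ b * (x₁ - x₃)) - σ (π * (x₃ - x₂) * s / (b * σ b * (x₁ - x₃)))) = Valued.v (ϖ ^ M) := by
  have h13 : x₁ ≠ x₃ := by
    intro h; rw [h, sub_self, map_zero] at hN; exact pow_ne_zero N hϖ ((Valuation.zero_iff _).1 hN.symm)
  have hNv : Valued.v (ϖ ^ N) ≠ 0 := (Valuation.ne_zero_iff _).2 (pow_ne_zero N hϖ)
  have h := v_G_sub_map_G_mul σ hσσ hσπ hσs hbv hσbv hsv hx₁ hx₂ hx₃ hx₂v h13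
  rw [hN, hπv, one_mul, hN₂, Valuation.map_sub_swap _ x₂ x₁, hN₁] at h
  have hMN : Valued.v (ϖ ^ N₂) * Valued.v (ϖ ^ N₁) = Valued.v (ϖ ^ M) * Valued.v (ϖ ^ N) := by
    rw [← map_mul, ← map_mul, ← pow_add, ← pow_add, add_comm N₂ N₁, hsum, add_comm N M]
  exact mul_right_cancel₀ hNv (h.trans hMN)

/-- **`|r(s+r)| = |ϖ^{M−N}|` when `N₁, N₂ ≥ 1`** (`|x₁ − x₂|, |x₃ − x₂| < 1`), and **`≤ |ϖ^{M−N}|` always**, from `|x₁ − x₃| = |ϖ^N|`, `|x₁ − x₂| = |ϖ^{N₁}|`, `|x₃ − x₂| = |ϖ^{N₂}|`,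
`N₁ + N₂ = N + M`, `N ≤ M` (`|ϖ| ≤ 1`, `ϖ ≠ 0`) — CENSUS-Large §0 (4) `hCv` (★'s `hc₁` ∕ ED. 2). [cite: Flicker1998UnitaryFL, Prop. 13 pp. 91–93] -/
theorem v_r_mul_s_add_r_pow {b s x₁ x₂ x₃ ϖ : K} {N N₁ N₂ M : ℕ} (hb : b + σ b = 1) (hσbv : Valued.v (σ b) ≤ 1) (hsv : Valued.v s = 1) (hx₂v : Valued.v x₂ = 1)
    (hϖ : ϖ ≠ 0) (hϖ1 : Valued.v ϖ ≤ 1)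
    (hN : Valued.v (x₁ - x₃) = Valued.v (ϖ ^ N)) (hN₁ : Valued.v (x₁ - x₂) = Valued.v (ϖ ^ N₁)) (hN₂ : Valued.v (x₃ - x₂) = Valued.v (ϖ ^ N₂))
    (hsum : N₁ + N₂ = N + M) (hNM : N ≤ M) :
    Valued.v ((x₃ - x₂) * s * (b * x₂ + σ b * x₁) / ((x₁ - x₃) * x₂) * (s + (x₃ - x₂) * s * (b * x₂ + σ b * x₁) / ((x₁ - x₃) * x₂))) ≤ Valued.v (ϖ ^ (M - N)) ∧
      (Valued.v (x₁ - x₂) < 1 → Valued.v (x₃ - x₂) < 1 →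
        Valued.v ((x₃ - x₂) * s * (b * x₂ + σ b * x₁) / ((x₁ - x₃) * x₂) * (s + (x₃ - x₂) * s * (b * x₂ + σ b * x₁) / ((x₁ - x₃) * x₂))) = Valued.v (ϖ ^ (M - N))) := by
  have h13 : x₁ ≠ x₃ := by
    intro h; rw [h, sub_self, map_zero] at hN; exact pow_ne_zero N hϖ ((Valuation.zero_iff _).1 hN.symm)
  have hNv : Valued.v (ϖ ^ N) ≠ 0 := (Valuation.ne_zero_iff _).2 (pow_ne_zero N hϖ)
  have hN2v : Valued.v (ϖ ^ N) ^ 2 ≠ 0 := pow_ne_zero 2 hNv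
  have key := v_r_mul_s_add_r_mul σ hb hsv hx₂v h13
  rw [hN, hN₁, hN₂] at key
  -- `|ϖ^{N₂}|·|ϖ^{N₁}| = |ϖ^N|²·|ϖ^{M−N}|`
  have hpow : Valued.v (ϖ ^ N₂) * Valued.v (ϖ ^ N₁) = Valued.v (ϖ ^ N) ^ 2 * Valued.v (ϖ ^ (M - N)) := by
    rw [← map_mul, ← pow_add, ← map_pow, ← map_mul, ← pow_mul, ← pow_add]
    congr 2
    omega
  have hu₁ : Valued.v (x₂ + σ b * (x₁ - x₂)) ≤ 1 := v_add_mul_sub_le_one σ hx₂v.le hσbv (by rw [hN₁, map_pow]; exact pow_le_one₀ zero_le hϖ1)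
  have hu₃ : Valued.v (x₂ + σ b * (x₃ - x₂)) ≤ 1 := v_add_mul_sub_le_one σ hx₂v.le hσbv (by rw [hN₂, map_pow]; exact pow_le_one₀ zero_le hϖ1)
  set C := Valued.v ((x₃ - x₂) * s * (b * x₂ + σ b * x₁) / ((x₁ - x₃) * x₂) * (s + (x₃ - x₂) * s * (b * x₂ + σ b * x₁) / ((x₁ - x₃) * x₂))) with hC
  rw [hpow] at key
  have key' : C * Valued.v (ϖ ^ N) ^ 2 = Valued.v (ϖ ^ (M - N)) * (Valued.v (x₂ + σ b * (x₁ - x₂)) * Valued.v (x₂ + σ b * (x₃ - x₂))) * Valued.v (ϖ ^ N) ^ 2 :=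
    key.trans (by ac_rfl)
  have hCeq : C = Valued.v (ϖ ^ (M - N)) * (Valued.v (x₂ + σ b * (x₁ - x₂)) * Valued.v (x₂ + σ b * (x₃ - x₂))) := mul_right_cancel₀ hN2v key'
  refine ⟨?_, fun h₁ h₃ => ?_⟩
  · rw [hCeq]
    exact mul_le_of_le_one_right zero_le ((mul_le_mul' hu₁ hu₃).trans_eq (one_mul 1))
  · rw [hCeq, v_add_mul_sub_eq_one σ hx₂v hσbv h₁, v_add_mul_sub_eq_one σ hx₂v hσbv h₃, mul_one, mul_one]

end Valued

end Literature.NumberTheory.Automorphic.UnitaryGroup
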